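/-
Copyright (c) 2026. All rights reserved.
Released under Apache 2.0 license as described in the file LICENSE.
Authors: abc-iut cell, seat abc-iut-f-069 (gen 3; the Prop 1.3 (ii) exact sequence at constructed data).
-/
import Literature.AnabelianGeometry.AbsoluteAnabelian.AbsTopII.DPSCDataOfOuterActionEdges
import Literature.AnabelianGeometry.AbsoluteAnabelian.AbsTopII.InertiaDecompositionNodes
import Literature.AnabelianGeometry.AbsoluteAnabelian.AbsTopII.DPSCIndexDataOfEmbedding

/-!
# [AbsTopII] Prop 1.3 (ii), the exact sequence `1 → Π_e → I_e → I → 1`, at `Π_𝒢 ⋊^out_θ J`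

S. Mochizuki, *Topics in Absolute Anabelian Geometry II* [AbsTopII] (bib `MochizukiAbsTopII2013`; kurims
manuscript `paper:url-585b8d0ad0d9`), §1 Def 1.2 (ii) p. 10, Prop 1.3 (ii) p. 11: "Suppose that `e` is a node
… Then we have a natural exact sequence `1 → Π_e → I_e → I → 1`"; [CombGC] (bib `MochizukiCombGC2007`)
Rmk 1.1.3, Prop 1.2 (ii).

PROOF-ONLY (no definition).  The FIRST clause of abc-iut-L4-t6's `Prop_1_3_ii` / `Prop_1_3_ii'` (F-0298 and
its successor) — `Π_e ≤ I_e`, `I_e ∩ Π_𝔾 = Π_e`, `I_e · Π_𝔾 = Π_I` — at the constructed DPSC-extension from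
hypotheses on the construction data: node groups abelian and commensurably terminal in `Π_𝒢` ([CombGC]
Rmk 1.1.3, Prop 1.2 (ii) = F-0438), Π_v-fixing lifts of `ρ_I` (profinite Dehn twists).  Assembly of
abc-iut-f-069's `prop13ii_clauses_ofOuterAction_of_dehn` (p444982) and `IvNode_inf_PiG_eq` (p428207).
The remaining clauses of (ii)/(ii)′ ("`I_e ≅ Ẑ^Σ × Ẑ^Σ`", the branch pair of index `i^Σ_e`) stay
Π_I-level inputs.  HONEST FRAMING: classical group theory; typed ≠ proved for the named inputs; nothing
here bears on [IUTchIII] Cor 3.12 or takes a side on any author.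
-/

noncomputable section

open scoped Pointwise

namespace Literature.AnabelianGeometry.AbsoluteAnabelian

open Literature.AnabelianGeometry.EtaleTheta (contMulAut mem_contMulAut TopOut)
open Literature.AnabelianGeometry.SemiGraphs
open Topology

universe u

namespace DPSCData

section OuterAction

variable {P : Type u} [Group P] [TopologicalSpace P] [IsTopologicalGroup P] [CompactSpace P]
  [TotallyDisconnectedSpace P] (G : PSCDatum P) (hG : IsTopologicallyFinitelyGenerated P)
  (hZ : Subgroup.center P = ⊥)
  {J : Type u} [Group J] [TopologicalSpace J] [IsTopologicalGroup J] [CompactSpace J]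
  [TotallyDisconnectedSpace J] (θ : J →ₜ* outProfinite hG) (I : Subgroup J) [I.Normal]

include hZ in
/-- **[AbsTopII] Prop 1.3 (ii), "`1 → Π_e → I_e → I → 1`" at `Π_𝒢 ⋊^out_θ J`** — the first clause of
`Prop_1_3_ii` / `Prop_1_3_ii'` for every node: `Π_e ≤ I_e` (node groups abelian), `I_e ∩ Π_𝔾 = Π_e` (abelian +
commensurably terminal in `Π_𝒢`, [CombGC] Prop 1.2 (ii)), `I_e · Π_𝔾 = Π_I` (Π_v-fixing lifts of `ρ_I`).
[cite: MochizukiAbsTopII2013, Prop 1.3 (ii) p.11] [cite: MochizukiCombGC2007, Prop 1.2(ii) p.8] -/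
theorem IvNode_exact_ofOuterAction_of_dehn
    (hCT : G.VerticialEdgeLikeCommensurablyTerminal)
    (hnab : ∀ (e : G.graph.N), ∀ x ∈ G.nodeGp e, ∀ y ∈ G.nodeGp e, x * y = y * x)
    (hDehn : ∀ (v : G.graph.V) (i : J), i ∈ I → ∃ φ : P ≃ₜ* P,
      TopOut.mk P ⟨φ.toMulEquiv, (mem_contMulAut P).mpr ⟨φ.continuous, φ.symm.continuous⟩⟩ =
        outerActionOfContinuous hG θ i ∧ ∀ x ∈ G.vertGp v, φ x = x)
    (n : (ofOuterAction G hG θ I).Node) :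
    (ofOuterAction G hG θ I).nodeSub n ≤ (ofOuterAction G hG θ I).IvNode n ∧
      (ofOuterAction G hG θ I).IvNode n ⊓ (ofOuterAction G hG θ I).PiG = (ofOuterAction G hG θ I).nodeSub n ∧
      (ofOuterAction G hG θ I).IvNode n ⊔ (ofOuterAction G hG θ I).PiG = (ofOuterAction G hG θ I).PiI := by
  obtain ⟨h1, h3⟩ := prop13ii_clauses_ofOuterAction_of_dehn G hG θ I hnab hDehn n
  refine ⟨h1, ?_, h3⟩
  -- commensurable terminality of `Π_e` in `Π_𝔾` from layer L3 through the presentation of the embedded datum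
  obtain ⟨e, he⟩ := exists_rangeEquiv G _ _ (isClosed_range_inlProfinite hG θ) (range_inlProfinite_normal hG θ)
    (I.comap (sndProfinite hG θ).toMonoidHom) inferInstance (range_inl_le_comap_snd hG θ I)
    (inlProfinite hG θ).continuous (inlProfinite_injective hG θ hZ)
  have hCTn : IsCommensurablyTerminal (((ofOuterAction G hG θ I).nodeSub n).subgroupOf
      (ofOuterAction G hG θ I).PiG) :=
    (ofOuterAction G hG θ I).isCommensurablyTerminal_nodeSub_of_psc
      (G.mapAlong e.toMulEquiv.toMonoidHom e.continuous G.Sigma subset_rfl G.sigma_nonempty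
        (G.proSigma.of_continuousMulEquiv e))
      Equiv.ulift (nodeSub_presentation G _ _ _ _ _ _ _ he)
      ((PSCDatum.verticialEdgeLikeCommensurablyTerminal_mapAlong_equiv_iff G e _ _ _ _).mpr hCT) n
  refine (ofOuterAction G hG θ I).IvNode_inf_PiG_eq n hCTn ?_
  rintro _ ⟨x, hx, rfl⟩ _ ⟨y, hy, rfl⟩
  show (inlProfinite hG θ).toMonoidHom x * (inlProfinite hG θ).toMonoidHom y =
    (inlProfinite hG θ).toMonoidHom y * (inlProfinite hG θ).toMonoidHom x
  rw [← map_mul, ← map_mul, hnab n.down x hx y hy]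

end OuterAction

end DPSCData

/-! ## Prop 1.3 (viii)′ at the constructed data: "`I_v ↠ I`" discharged -/

namespace AbsTopII.DPSCIndexData

section OuterAction

open Literature.AnabelianGeometry.Anabelioids (IsSigmaInteger)

variable {P : Type u} [Group P] [TopologicalSpace P] [IsTopologicalGroup P] [CompactSpace P]
  [TotallyDisconnectedSpace P] (G : PSCDatum P) (hG : IsTopologicallyFinitelyGenerated P)
  {J : Type u} [Group J] [TopologicalSpace J] [IsTopologicalGroup J] [CompactSpace J]
  [TotallyDisconnectedSpace J] (θ : J →ₜ* outProfinite hG) (I : Subgroup J) [I.Normal]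
  (σ : G.graph.N → ℕ) (hσ : ∀ e, IsSigmaInteger G.Sigma (σ e))

/-- **[AbsTopII] Prop 1.3 (viii)′ AS TYPED at `Π_𝒢 ⋊^out_θ J`** — abc-iut-f-069's `prop_1_3_viii'_of_branch`
(p439117) with its "`I_v ↠ I`" hypothesis DISCHARGED by Π_v-fixing lifts of `ρ_I`; the DICHOTOMY (1)/(2) of
(viii) with the common-branch-vertex clause (pp. 16–19, log étale cyclic coverings) stays the hypothesis.
[cite: MochizukiAbsTopII2013, Prop 1.3 (viii) p.12] -/
theorem prop_1_3_viii'_ofOuterAction_of_dehn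
    (hdich : ∀ (e e' : (ofOuterAction G hG θ I σ hσ).Edge) (γ : (ofOuterAction G hG θ I σ hσ).PiH),
      γ ∈ (ofOuterAction G hG θ I σ hσ).PiG →
      (ofOuterAction G hG θ I σ hσ).DEdge e ⊓ MulAut.conj γ • (ofOuterAction G hG θ I σ hσ).DEdge e' ⊓
          (ofOuterAction G hG θ I σ hσ).PiI ≠ ⊥ →
      e = e' ∨
        (e ≠ e' ∧ ∃ v : (ofOuterAction G hG θ I σ hσ).Vert,
          (ofOuterAction G hG θ I σ hσ).EdgeAbuts e v ∧ (ofOuterAction G hG θ I σ hσ).EdgeAbuts e' v ∧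
          (ofOuterAction G hG θ I σ hσ).DEdge e ⊓ MulAut.conj γ • (ofOuterAction G hG θ I σ hσ).DEdge e' ⊓
              (ofOuterAction G hG θ I σ hσ).PiG = ⊥ ∧
          ∃ h : (ofOuterAction G hG θ I σ hσ).PiH, h ∈ (ofOuterAction G hG θ I σ hσ).PiG ∧
            (Sum.elim (ofOuterAction G hG θ I σ hσ).nodeSub (ofOuterAction G hG θ I σ hσ).cuspSub e :
                Subgroup (ofOuterAction G hG θ I σ hσ).PiH) ≤
              MulAut.conj h • (ofOuterAction G hG θ I σ hσ).vertSub v ∧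
            MulAut.conj γ • (Sum.elim (ofOuterAction G hG θ I σ hσ).nodeSub
                (ofOuterAction G hG θ I σ hσ).cuspSub e' : Subgroup (ofOuterAction G hG θ I σ hσ).PiH) ≤
              MulAut.conj h • (ofOuterAction G hG θ I σ hσ).vertSub v))
    (hDehn : ∀ (v : G.graph.V) (i : J), i ∈ I → ∃ φ : P ≃ₜ* P,
      TopOut.mk P ⟨φ.toMulEquiv, (mem_contMulAut P).mpr ⟨φ.continuous, φ.symm.continuous⟩⟩ =
        outerActionOfContinuous hG θ i ∧ ∀ x ∈ G.vertGp v, φ x = x) :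
    Literature.AnabelianGeometry.AbsoluteAnabelian.AbsTopII.DPSCIndexData.Prop_1_3_viii'
      (ofOuterAction G hG θ I σ hσ) :=
  (ofOuterAction G hG θ I σ hσ).prop_1_3_viii'_of_branch hdich fun v =>
    DPSCData.Iv_sup_PiG_eq_PiI_ofOuterAction G hG θ I v (fun i hi => hDehn v.down i hi)

end OuterAction

end AbsTopII.DPSCIndexData

end Literature.AnabelianGeometry.AbsoluteAnabelian

end
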